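import Literature.RingTheory.PowerSeries.CartierOperator
import Literature.RingTheory.PowerSeries.LaurentCartierOperator
import HarnessLib

/-!
# The Laurent-series Cartier operator restricts to the power-series one along `R⟦x⟧ ↪ R⸨x⸩`

Topic `Literature/RingTheory/PowerSeries`; namespace `Literature.RingTheory.PowerSeries`.  Lane `lit-hodgefound`
(Track 2 foundations library), seat p01 gen 20, row g20-#11 (link file).  THEOREMS ONLY (no definition, no
named fact, no instance, no notation; D-0014/D-0026, net Literature debt 0).  Joins g20-#8
(`powerSeriesCartierTwist`, `powerSeriesCartier` on `R⟦x⟧ dx`) and g20-#9 (`laurentCartierTwist`,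
`laurentCartier` on `R⸨x⸩ dx`), which were filed independently: the operators agree on regular forms
(Lang's C6 «If `ω` is regular at a place …, then `Cω` is also regular at this place»), so the three levels
`R[x] dx ⊂ R⟦x⟧ dx ⊂ R⸨x⸩ dx` of g20-#1/#8/#9 carry ONE Cartier operator.
[cite: Lang1987, Appendix 1 §4 C6]
-/

noncomputable section

open HahnSeries LaurentSeries PowerSeries

namespace Literature.RingTheory.PowerSeries

section Twist

variable {R : Type*} [CommRing R] (p : ℕ) [Fact p.Prime]

/-- **C6, operator form**: `U` on `R⸨x⸩ dx` restricted to `R⟦x⟧ dx` is the power-series `U` of g20-#8.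
[cite: Lang1987, Appendix 1 §4 C6] -/
theorem laurentCartierTwist_coe_powerSeries (φ : R⟦X⟧) :
    laurentCartierTwist p (φ : R⸨X⸩) = ((powerSeriesCartierTwist p φ : R⟦X⟧) : R⸨X⸩) := by
  ext n
  rw [laurentCartierTwist_ofPowerSeries, coeff_coe_powerSeries_int, coeff_coe_powerSeries_int]
  split_ifs
  · rw [PowerSeries.coeff_mk, coeff_powerSeriesCartierTwist]
  · rfl

end Twist

section Perfect

variable {R : Type*} [CommRing R] (p : ℕ) [Fact p.Prime] [CharP R p] [PerfectRing R p]

/-- **C6, operator form**: `𝒞` on `R⸨x⸩ dx` restricted to `R⟦x⟧ dx` is the power-series `𝒞` of g20-#8.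
[cite: Lang1987, Appendix 1 §4 C6] -/
theorem laurentCartier_coe_powerSeries (φ : R⟦X⟧) :
    laurentCartier p (φ : R⸨X⸩) = ((powerSeriesCartier p φ : R⟦X⟧) : R⸨X⸩) := by
  ext n
  rw [laurentCartier_ofPowerSeries, coeff_coe_powerSeries_int, coeff_coe_powerSeries_int]
  split_ifs
  · rw [PowerSeries.coeff_mk, coeff_powerSeriesCartier]
  · rfl

/-- Hence the residue statement C7 for a REGULAR form is vacuous-compatible: `res 𝒞(φ dx) = 0 = (res φ dx)^{1/p}`
for `φ ∈ R⟦x⟧`. [cite: Lang1987, Appendix 1 §4 C6–C7] -/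
theorem coeff_neg_one_laurentCartier_coe_powerSeries (φ : R⟦X⟧) :
    (laurentCartier p (φ : R⸨X⸩)).coeff (-1) = 0 := by
  rw [coeff_neg_one_laurentCartier, coeff_coe_powerSeries_int, if_neg (by norm_num), map_zero]

end Perfect

end Literature.RingTheory.PowerSeries
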